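import Literature.Probability.Percolation.ArmSeparationOuter
import Literature.Probability.Percolation.ArmSeparationTubes
import HarnessLib

/-!
# The spoke of an outer fenced tip: from the corner box of the fence to the ring road

Topic: Probability / Percolation; family `crit-perc`. A brick of the discharge of
`Literature.Probability.Percolation.Nolin2008_twoArm_separation` (Nolin 2008, Thm. 11
[arXiv 0711.4948: Thm. 10]; `ArmSeparation.lean`), landing of the EXTERNAL extremities (mirror of
`ArmSeparationSpoke.lean`). A fenced arm behind side `0` of `∂Λ_{2M}` in the rotated frame `i`
(`TrapFencedArm M n k₀ K (rotConfig i ω)`, `ArmSeparationOuter.lean`) ends, through its fence, at a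
site `m` of an open vertical crossing of the corner box `[2M+k, 2M+2k] × [z₁+k, z₁+2k]` outside
`Λ_{2M}`. The corridor of the arm starts with the **spoke**: a thin horizontal tube of the frame
from the left column of the corner box outwards,
`extSpokeTube M k T₀ w L ε = [2M+k, 2M+k+L] × [T₀+w+k+k/4, T₀+w+k+k/4+2ε]`, placed from the window
`[T₀, T₀+w)` of the tip's row only, inside the rows of the corner box of every tip of the window.

* `extSpokeEvent i …` — the spoke is crossed (an increasing event of `ω`, read in the frame `i`),
  its support and probability (`determinedBy_extSpokeEvent`, `real_extSpokeEvent`).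
* `SpokeMeetsRot i Sp E` — the junction condition with a tube `E` of the original frame: read in
  the original frame the spoke of the frame `i` is the tube itself (`i = 0`), its central
  reflection (`i = 3`), a thin strip slanted along `x₁` (`i = 1, 4`, as for `frameIso`) or a thin
  strip slanted along the diagonal (`i = 2, 5`: `ρ²(x, y) = (-x-y, x)`); in all cases it is long
  in one coordinate direction and `E` lies across its far part.
* `trapArm_to_entry` — **from the fenced arm to the entry tube**: if the spoke is crossed and
  `E` is crossed with `SpokeMeetsRot i`, the start `ρ^i F.a` (norm `n`) of the arm is joined to
  the start of the crossing of `E` by an open path of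
  `ρ^i(annulus ∪ fence zone ∪ corner box ∪ spoke box) ∪ E.box` (the corner crossing catches the
  spoke: `exists_mem_of_cross` in the corner box; the spoke meets `E`: `exists_mem_of_cross` in
  the original frame, case by case).

## References

* P. Nolin, *Near-critical percolation in two dimensions*, Electron. J. Probab. 13 (2008), §4.3,
  proof of Prop. 12; §4.4 [arXiv 0711.4948: Prop. 11, Thm. 10]. [Nolin2008]
-/

noncomputable section

open Set MeasureTheory

namespace Literature.Probability.Percolation

open LatticeModels Tube

/-! ### The spoke -/

/-- **The spoke of the window `[T₀, T₀+w)` at scale `k`** (frame coordinates): the thin horizontal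
tube `[2M+k, 2M+k+L] × [T₀+w+k+k/4, T₀+w+k+k/4+2ε]` from the left column of the corner box
outwards. [cite: Nolin2008, §4.3 Prop. 12 (proof) (arXiv 0711.4948: Prop. 11)] -/
def extSpokeTube (M k : ℕ) (T₀ : ℤ) (w L ε : ℕ) : Tube :=
  ⟨2 * (M : ℤ) + k, T₀ + w + k + (k / 4 : ℕ), L, 2 * ε, true⟩

/-- **The spoke is crossed** (an event of the original configuration, read in the rotated frame `i`). [cite: Nolin2008, §4.3 Prop. 12 (proof) (arXiv 0711.4948: Prop. 11)] -/
def extSpokeEvent (i M k : ℕ) (T₀ : ℤ) (w L ε : ℕ) : Set (SiteConfig (Site 2)) :=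
  rotConfig i ⁻¹' (extSpokeTube M k T₀ w L ε).event

/-- Rotating the frame is monotone. [folklore] -/
theorem rotConfig_mono (i : ℕ) {ω ω' : SiteConfig (Site 2)} (h : ω ≤ ω') : rotConfig i ω ≤ rotConfig i ω' :=
  fun v hv => by rw [mem_rotConfig] at hv ⊢; exact h hv

/-- Pulling an event back by a rotation preserves monotonicity. [folklore] -/
theorem isUpperSet_preimage_rotConfig (i : ℕ) {E : Set (SiteConfig (Site 2))} (hE : IsUpperSet E) :
    IsUpperSet (rotConfig i ⁻¹' E) := fun _ _ hle h => hE (rotConfig_mono i hle) h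

/-- The spoke event is increasing. [folklore] -/
theorem isUpperSet_extSpokeEvent (i M k : ℕ) (T₀ : ℤ) (w L ε : ℕ) : IsUpperSet (extSpokeEvent i M k T₀ w L ε) :=
  isUpperSet_preimage_rotConfig i (extSpokeTube M k T₀ w L ε).isUpperSet_event

/-- The spoke event is determined by the rotated image of the spoke's box. [folklore] -/
theorem determinedBy_extSpokeEvent (i M k : ℕ) (T₀ : ℤ) (w L ε : ℕ) :
    DeterminedBy (extSpokeEvent i M k T₀ w L ε) (triRotIsoPow i '' (extSpokeTube M k T₀ w L ε).box) := by
  have h := determinedBy_preimage_rotConfig i (extSpokeTube M k T₀ w L ε).determinedBy_event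
  rwa [coe_sites] at h

/-- The probability of the spoke event is that of crossing the spoke tube. [folklore] -/
theorem real_extSpokeEvent (i M k : ℕ) (T₀ : ℤ) (w L ε : ℕ) :
    (triSitePercolation half).real (extSpokeEvent i M k T₀ w L ε) =
      (triSitePercolation half).real (extSpokeTube M k T₀ w L ε).event :=
  real_preimage_rotConfig half i _

/-! ### The junction condition -/

/-- **The spoke of the rotated frame `i` meets the tube `E` of the original frame**: `E` lies
across the far part of `ρ^i(spoke)` like a plus sign — frame by frame, `ρ^i(spoke)` being the tube
itself (`i = 0`), a strip slanted along `x₁` (`i = 1`), a strip slanted along the diagonal and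
long in `x₁` (`i = 2`), and their central reflections (`i = 3, 4, 5`). [cite: Nolin2008, §4.3 Prop. 12 (proof) (arXiv 0711.4948: Prop. 11)] -/
def SpokeMeetsRot (i : ℕ) (Sp E : Tube) : Prop :=
  match i with
  | 0 => E.horiz = false ∧ Sp.a ≤ E.a ∧ E.a + E.w ≤ Sp.a + Sp.w ∧ E.b ≤ Sp.b ∧ Sp.b + Sp.h ≤ E.b + E.h
  | 1 => E.horiz = true ∧ E.a ≤ -(Sp.b + Sp.h) ∧ -Sp.b ≤ E.a + E.w ∧ Sp.a + Sp.b + Sp.h ≤ E.b ∧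
      E.b + E.h ≤ Sp.a + Sp.w + Sp.b
  | 2 => E.horiz = true ∧ E.a + E.b + E.h + Sp.b + Sp.h ≤ 0 ∧ -E.b - Sp.b ≤ E.a + E.w ∧ Sp.a ≤ E.b ∧
      E.b + E.h ≤ Sp.a + Sp.w
  | 3 => E.horiz = false ∧ -(Sp.a + Sp.w) ≤ E.a ∧ E.a + E.w ≤ -Sp.a ∧ E.b ≤ -(Sp.b + Sp.h) ∧ -Sp.b ≤ E.b + E.h
  | 4 => E.horiz = true ∧ E.a ≤ Sp.b ∧ Sp.b + Sp.h ≤ E.a + E.w ∧ -(Sp.a + Sp.w) - Sp.b ≤ E.b ∧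
      E.b + E.h ≤ -Sp.a - Sp.b - Sp.h
  | 5 => E.horiz = true ∧ E.a + E.b + E.h ≤ Sp.b ∧ Sp.b + Sp.h - E.b ≤ E.a + E.w ∧ -(Sp.a + Sp.w) ≤ E.b ∧
      E.b + E.h ≤ -Sp.a
  | _ => False

/-! ### The hook -/

/-- Reading a frame path in the original frame. [folklore] -/
theorem pathIn_of_rotConfig_open (i : ℕ) {A : Set (Site 2)} {ω : SiteConfig (Site 2)} {x y : Site 2}
    (h : PathIn triGraph (A ∩ rotConfig i ω) x y) :
    PathIn triGraph ((triRotIsoPow i '' A) ∩ ω) (triRotIsoPow i x) (triRotIsoPow i y) := by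
  have h' : PathIn triGraph (A ∩ {v | v ∈ rotConfig i ω ↔ true}) x y := h.mono fun v hv => ⟨hv.1, by simpa using hv.2⟩
  exact (pathIn_of_rotConfig i h').mono fun v hv => ⟨hv.1, by simpa using hv.2⟩

/-- **From the fenced arm to the entry tube.** Let `F` be a fenced arm of `rotConfig i ω` behind
side `0`, its tip in the window `[T₀, T₀+w)`, the spoke crossed (`extSpokeEvent i`), and `E` a tube
of the original frame crossed from `xE` to `yE` with `SpokeMeetsRot i`. Then the start `ρ^i F.a` of
the arm (a site of norm `n`) is joined to `xE` by an open path of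
`ρ^i(spoke box ∪ annulus ∪ fence zone ∪ corner box) ∪ E.box`. [cite: Nolin2008, §4.3 Prop. 12 (proof) and §4.4 (arXiv 0711.4948: Prop. 11, Thm. 10)] -/
theorem trapArm_to_entry {M n k₀ K : ℕ} {i : ℕ} (hi : i < 6) {ω : SiteConfig (Site 2)}
    (F : TrapFencedArm M n k₀ K (rotConfig i ω)) {T₀ : ℤ} {w : ℕ} (hwin : T₀ ≤ F.z 1 ∧ F.z 1 < T₀ + w)
    {L ε : ℕ} (hfit : (w : ℤ) + (F.k / 4 : ℕ) + 2 * ε ≤ F.k) (hL : F.k + 1 ≤ L)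
    (hSp : ω ∈ extSpokeEvent i M F.k T₀ w L ε)
    {E : Tube} {xE yE : Site 2} (hE : E.IsCrossing ω xE yE) (hJ : SpokeMeetsRot i (extSpokeTube M F.k T₀ w L ε) E) :
    PathIn triGraph ((triRotIsoPow i '' ((extSpokeTube M F.k T₀ w L ε).box ∪
        (triAnnSet n (2 * M) ∪ trapFrameZone M F.z F.k ∪ triStrip (F.z 0 + F.k) (F.z 1 + F.k) F.k F.k)) ∪ E.box) ∩ ω)
      (triRotIsoPow i F.a) xE := by
  obtain ⟨Sp, hSp'⟩ : ∃ Sp : Tube, Sp = extSpokeTube M F.k T₀ w L ε := ⟨_, rfl⟩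
  have hSa : Sp.a = 2 * (M : ℤ) + F.k := by rw [hSp']; rfl
  have hSb : Sp.b = T₀ + w + F.k + (F.k / 4 : ℕ) := by rw [hSp']; rfl
  have hSw : Sp.w = L := by rw [hSp']; rfl
  have hSh : Sp.h = 2 * ε := by rw [hSp']; rfl
  have hSp2 : rotConfig i ω ∈ Sp.event := by rw [hSp']; exact hSp
  rw [← hSp'] at hJ ⊢
  obtain ⟨hz0, hz1, hz1'⟩ := trapO_coord F.z_mem
  have hL' : (F.k : ℤ) + 1 ≤ L := by exact_mod_cast hL
  -- (1) the crossing of the spoke in the frame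
  obtain ⟨x', y', hs, P'⟩ := Sp.exists_isCrossing hSp2
  have hs' : x' 0 = Sp.a ∧ y' 0 = Sp.a + Sp.w := by rw [hSp'] at hs ⊢; exact hs
  obtain ⟨SH, hSH, PH, TH⟩ := P'.exists_support
  have hSHb : ∀ v ∈ SH, Sp.a ≤ v 0 ∧ v 0 ≤ Sp.a + Sp.w ∧ Sp.b ≤ v 1 ∧ v 1 ≤ Sp.b + Sp.h := fun v hv =>
    (Tube.mem_box Sp).1 (hSH hv).1
  -- (2) the corner crossing catches the spoke (frame coordinates)
  obtain ⟨⟨b, t, hb1, ht1, Pb, Pt⟩, -⟩ := F.tipOK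
  obtain ⟨S₁, hS₁, PS₁, TS₁⟩ := Pb.symm.exists_support
  obtain ⟨S₂, hS₂, PS₂, TS₂⟩ := Pt.exists_support
  have PV : PathIn triGraph (S₁ ∪ S₂) b t := (PS₁.symm.mono subset_union_left).trans (PS₂.mono subset_union_right)
  have hSVb : ∀ v ∈ S₁ ∪ S₂, F.z 0 + F.k ≤ v 0 ∧ v 0 ≤ F.z 0 + F.k + F.k ∧ F.z 1 + F.k ≤ v 1 ∧ v 1 ≤ F.z 1 + F.k + F.k := by
    rintro v (hv | hv)
    · exact (mem_triStrip.1 (hS₁ hv).1)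
    · exact (mem_triStrip.1 (hS₂ hv).1)
  have hk : ((trapScale k₀ F.j : ℕ) : ℤ) = F.k := rfl
  obtain ⟨u, huH, huV⟩ := exists_mem_of_cross (L := F.z 0 + F.k) (R := F.z 0 + 2 * F.k) (B := F.z 1 + F.k) (T := F.z 1 + 2 * F.k)
    (by omega) (by omega) PH (by rw [hs'.1, hSa]; omega) (by rw [hs'.2, hSa, hSw]; omega)
    (fun v hv _ _ => by have := hSHb v hv; omega)
    PV (by rw [hk] at hb1; omega) (by rw [hk] at ht1; omega) (fun v hv _ _ => by have := hSVb v hv; omega)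
  -- from `m` to `u` inside the corner box, then along the spoke to its far end `y'`
  have Pmu : PathIn triGraph (triStrip (F.z 0 + F.k) (F.z 1 + F.k) F.k F.k ∩ rotConfig i ω) F.m u := by
    rcases huV with hu | hu
    · exact (TS₁ u hu).mono hS₁
    · exact (TS₂ u hu).mono hS₂
  have Puy : PathIn triGraph (Sp.box ∩ rotConfig i ω) u y' := ((TH u huH).symm.trans (TH y' PH.right_mem)).mono hSH
  have Pframe : PathIn triGraph ((Sp.box ∪ (triAnnSet n (2 * M) ∪ trapFrameZone M F.z F.k ∪ triStrip (F.z 0 + F.k) (F.z 1 + F.k) F.k F.k)) ∩ rotConfig i ω) F.a y' := by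
    refine ((F.path.mono ?_).trans (Pmu.mono ?_)).trans (Puy.mono ?_)
    · rintro v ⟨hv, hvχ⟩; exact ⟨Or.inr (Or.inl hv), hvχ⟩
    · rintro v ⟨hv, hvχ⟩; exact ⟨Or.inr (Or.inr hv), hvχ⟩
    · rintro v ⟨hv, hvχ⟩; exact ⟨Or.inl hv, hvχ⟩
  -- (3) read in the original frame
  have Pphys := pathIn_of_rotConfig_open i Pframe
  have PSphys := pathIn_of_rotConfig_open i (PH.mono hSH)
  obtain ⟨S, hS, PS, TS⟩ := PSphys.exists_support
  have hSω : S ⊆ ω := fun v hv => (hS hv).2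
  have physS : ∀ v ∈ S, ∃ q ∈ Sp.box, triRotIsoPow i q = v := fun v hv => by
    obtain ⟨⟨q, hq, hqv⟩, -⟩ := hS hv; exact ⟨q, hq, hqv⟩
  have star : ∀ p ∈ S, ∀ q ∈ S, PathIn triGraph S p q := fun p hp q hq => (TS p hp).symm.trans (TS q hq)
  -- (4) the spoke meets the crossing of `E`
  obtain ⟨SE, hSE, PE, TE⟩ := hE.2.exists_support
  have hEbox : ∀ z ∈ SE, E.a ≤ z 0 ∧ z 0 ≤ E.a + E.w ∧ E.b ≤ z 1 ∧ z 1 ≤ E.b + E.h := fun z hz =>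
    (Tube.mem_box E).1 (hSE hz).1
  have hE1 := hE.1
  have hy'b : Sp.a ≤ y' 0 ∧ y' 0 ≤ Sp.a + Sp.w ∧ Sp.b ≤ y' 1 ∧ y' 1 ≤ Sp.b + Sp.h := hSHb y' PH.right_mem
  have hx'b : Sp.a ≤ x' 0 ∧ x' 0 ≤ Sp.a + Sp.w ∧ Sp.b ≤ x' 1 ∧ x' 1 ≤ Sp.b + Sp.h := hSHb x' PH.left_mem
  have meet : ∃ z, z ∈ S ∧ z ∈ SE := by
    interval_cases i
    · -- frame 0: the spoke is the horizontal tube itself; `E` vertical across its far part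
      obtain ⟨hEh, h1, h2, h3, h4⟩ := hJ
      rw [hEh] at hE1
      obtain ⟨hxE, hyE⟩ : xE 1 = E.b ∧ yE 1 = E.b + E.h := hE1
      obtain ⟨fx0, -⟩ := rot_apply_formula x'
      obtain ⟨fy0, -⟩ := rot_apply_formula y'
      refine exists_mem_of_cross (L := E.a) (R := E.a + E.w) (B := E.b) (T := E.b + E.h) (by omega) (by omega)
        PS (by rw [fx0]; omega) (by rw [fy0]; omega) (fun z hz _ _ => ?_) PE (by omega) (by omega)
        (fun z hz _ _ => ⟨(hEbox z hz).1, (hEbox z hz).2.1⟩)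
      obtain ⟨q, hq, rfl⟩ := physS z hz
      obtain ⟨g0, g1, -⟩ := rot_apply_formula q
      rw [Tube.mem_box] at hq; rw [g0, g1] at *; constructor <;> omega
    · -- frame 1 (`ρ`): the strip `x₀ ∈ [-(b+h), -b]`, `x₀ + x₁ ∈ [a, a+w]`; `E` horizontal
      obtain ⟨hEh, h1, h2, h3, h4⟩ := hJ
      rw [hEh] at hE1
      obtain ⟨hxE, hyE⟩ : xE 0 = E.a ∧ yE 0 = E.a + E.w := hE1
      obtain ⟨-, -, fx0, fx1, -⟩ := rot_apply_formula x'
      obtain ⟨-, -, fy0, fy1, -⟩ := rot_apply_formula y'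
      obtain ⟨z, hzE, hzS⟩ := exists_mem_of_cross (L := -(Sp.b + Sp.h)) (R := -Sp.b) (B := E.b) (T := E.b + E.h)
        (by omega) (by omega) PE (by omega) (by omega) (fun z hz _ _ => ⟨(hEbox z hz).2.2.1, (hEbox z hz).2.2.2⟩)
        PS (by rw [fx1]; omega) (by rw [fy1]; omega) (fun z hz _ _ => by
          obtain ⟨q, hq, rfl⟩ := physS z hz
          obtain ⟨-, -, g0, g1, -⟩ := rot_apply_formula q
          rw [Tube.mem_box] at hq; rw [g0]; constructor <;> omega)
      exact ⟨z, hzS, hzE⟩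
    · -- frame 2 (`ρ²`): the strip `x₁ ∈ [a, a+w]`, `x₀ + x₁ ∈ [-(b+h), -b]`; `E` horizontal
      obtain ⟨hEh, h1, h2, h3, h4⟩ := hJ
      rw [hEh] at hE1
      obtain ⟨hxE, hyE⟩ : xE 0 = E.a ∧ yE 0 = E.a + E.w := hE1
      obtain ⟨-, -, -, -, fx0, fx1, -⟩ := rot_apply_formula x'
      obtain ⟨-, -, -, -, fy0, fy1, -⟩ := rot_apply_formula y'
      obtain ⟨z, hzE, hzS⟩ := exists_mem_of_cross (L := E.a) (R := E.a + E.w) (B := E.b) (T := E.b + E.h)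
        (by omega) (by omega) PE (by omega) (by omega) (fun z hz _ _ => ⟨(hEbox z hz).2.2.1, (hEbox z hz).2.2.2⟩)
        PS (by rw [fx1]; omega) (by rw [fy1]; omega) (fun z hz hzlo hzhi => by
          obtain ⟨q, hq, rfl⟩ := physS z hz
          obtain ⟨-, -, -, -, g0, g1, -⟩ := rot_apply_formula q
          rw [Tube.mem_box] at hq; rw [g0]; rw [g1] at hzlo hzhi; constructor <;> omega)
      exact ⟨z, hzS, hzE⟩
    · -- frame 3 (`-id`): the reflected horizontal tube; `E` vertical
      obtain ⟨hEh, h1, h2, h3, h4⟩ := hJ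
      rw [hEh] at hE1
      obtain ⟨hxE, hyE⟩ : xE 1 = E.b ∧ yE 1 = E.b + E.h := hE1
      obtain ⟨-, -, -, -, -, -, fx0, fx1, -⟩ := rot_apply_formula x'
      obtain ⟨-, -, -, -, -, -, fy0, fy1, -⟩ := rot_apply_formula y'
      refine exists_mem_of_cross (L := E.a) (R := E.a + E.w) (B := E.b) (T := E.b + E.h) (by omega) (by omega)
        PS.symm (by rw [fy0]; omega) (by rw [fx0]; omega) (fun z hz _ _ => ?_) PE (by omega) (by omega)
        (fun z hz _ _ => ⟨(hEbox z hz).1, (hEbox z hz).2.1⟩)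
      obtain ⟨q, hq, rfl⟩ := physS z hz
      obtain ⟨-, -, -, -, -, -, g0, g1, -⟩ := rot_apply_formula q
      rw [Tube.mem_box] at hq; rw [g1]; constructor <;> omega
    · -- frame 4 (`ρ⁴ = -ρ`): the strip `x₀ ∈ [b, b+h]`, `x₀ + x₁ ∈ [-(a+w), -a]`; `E` horizontal
      obtain ⟨hEh, h1, h2, h3, h4⟩ := hJ
      rw [hEh] at hE1
      obtain ⟨hxE, hyE⟩ : xE 0 = E.a ∧ yE 0 = E.a + E.w := hE1
      obtain ⟨-, -, -, -, -, -, -, -, fx0, fx1, -⟩ := rot_apply_formula x'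
      obtain ⟨-, -, -, -, -, -, -, -, fy0, fy1, -⟩ := rot_apply_formula y'
      obtain ⟨z, hzE, hzS⟩ := exists_mem_of_cross (L := Sp.b) (R := Sp.b + Sp.h) (B := E.b) (T := E.b + E.h)
        (by omega) (by omega) PE (by omega) (by omega) (fun z hz _ _ => ⟨(hEbox z hz).2.2.1, (hEbox z hz).2.2.2⟩)
        PS.symm (by rw [fy1]; omega) (by rw [fx1]; omega) (fun z hz _ _ => by
          obtain ⟨q, hq, rfl⟩ := physS z hz
          obtain ⟨-, -, -, -, -, -, -, -, g0, g1, -⟩ := rot_apply_formula q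
          rw [Tube.mem_box] at hq; rw [g0]; constructor <;> omega)
      exact ⟨z, hzS, hzE⟩
    · -- frame 5 (`ρ⁵ = -ρ²`): the strip `x₁ ∈ [-(a+w), -a]`, `x₀ + x₁ ∈ [b, b+h]`; `E` horizontal
      obtain ⟨hEh, h1, h2, h3, h4⟩ := hJ
      rw [hEh] at hE1
      obtain ⟨hxE, hyE⟩ : xE 0 = E.a ∧ yE 0 = E.a + E.w := hE1
      obtain ⟨-, -, -, -, -, -, -, -, -, -, fx0, fx1⟩ := rot_apply_formula x'
      obtain ⟨-, -, -, -, -, -, -, -, -, -, fy0, fy1⟩ := rot_apply_formula y'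
      obtain ⟨z, hzE, hzS⟩ := exists_mem_of_cross (L := E.a) (R := E.a + E.w) (B := E.b) (T := E.b + E.h)
        (by omega) (by omega) PE (by omega) (by omega) (fun z hz _ _ => ⟨(hEbox z hz).2.2.1, (hEbox z hz).2.2.2⟩)
        PS.symm (by rw [fy1]; omega) (by rw [fx1]; omega) (fun z hz hzlo hzhi => by
          obtain ⟨q, hq, rfl⟩ := physS z hz
          obtain ⟨-, -, -, -, -, -, -, -, -, -, g0, g1⟩ := rot_apply_formula q
          rw [Tube.mem_box] at hq; rw [g0]; rw [g1] at hzlo hzhi; constructor <;> omega)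
      exact ⟨z, hzS, hzE⟩
  -- (5) assemble
  obtain ⟨z, hzS, hzE⟩ := meet
  have Q1 : PathIn triGraph ((triRotIsoPow i '' (Sp.box ∪ (triAnnSet n (2 * M) ∪ trapFrameZone M F.z F.k ∪ triStrip (F.z 0 + F.k) (F.z 1 + F.k) F.k F.k)) ∪ E.box) ∩ ω) (triRotIsoPow i F.a) (triRotIsoPow i y') :=
    Pphys.mono fun v hv => ⟨Or.inl hv.1, hv.2⟩
  have Q2 : PathIn triGraph ((triRotIsoPow i '' (Sp.box ∪ (triAnnSet n (2 * M) ∪ trapFrameZone M F.z F.k ∪ triStrip (F.z 0 + F.k) (F.z 1 + F.k) F.k F.k)) ∪ E.box) ∩ ω) (triRotIsoPow i y') z := by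
    refine (star _ PS.right_mem z hzS).mono fun v hv => ?_
    obtain ⟨q, hq, rfl⟩ := physS v hv
    exact ⟨Or.inl ⟨q, Or.inl hq, rfl⟩, hSω hv⟩
  have Q3 : PathIn triGraph ((triRotIsoPow i '' (Sp.box ∪ (triAnnSet n (2 * M) ∪ trapFrameZone M F.z F.k ∪ triStrip (F.z 0 + F.k) (F.z 1 + F.k) F.k F.k)) ∪ E.box) ∩ ω) z xE :=
    (TE z hzE).symm.mono fun v hv => ⟨Or.inr (hSE hv).1, (hSE hv).2⟩
  exact (Q1.trans Q2).trans Q3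

end Literature.Probability.Percolation
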